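import Mathlib
import HarnessLib

/-!
# NE7SecondDerivativeFromQuadraticBound — A DOMINATED SEMINORM OF THE SECOND DERIVATIVE ALONG A RAY IS AT MOST TWICE THE QUADRATIC CONSTANT OF THE FUNCTION: if `p(Ψ(tX) − t·DΨ(0)X) ≤ K·t²`
# for small `t > 0` (`Ψ` `C²` at `0`, `Ψ 0 = 0`, `p` subadditive, absolutely homogeneous and dominated by the norm) then `p(D²Ψ(0)[X,X]) ≤ 2K` (lineage `b2b-balaban-t4-ne7-p1`, gen 119,
# file H13 = ROAD-G119 §5 S4′ (iv), the «Taylor extraction» that converts the FUNCTION-level ℓ¹ letter of the stripped remainder into the letter on `D²Ψ(0)[X,X]` consumed by H11)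

Cell `pub-balaban`, rung (B)+1 sub-cell t4, CRUX PROVER NE7 #1 (OWNER of row NE7), generation 119.
WHY (memo ROAD-G119 §5 S4′).  H11 ✓ `NE7EffectiveFormLowerBoundSocket` closes (G′) modulo the letter `|Dm(0)[D²Ψ(0)[X,X]]| ≤ C_Λ·η²·dirSq X̃` for the stripped constraint `Ψ`; ✓
`NE7MultiplierDensity.multiplier_density_allData_uniform` bounds `|Dm(0)[γ]|` by the torus ℓ¹ mass of `γ`; H12 ✓ `NE7StrippedStepRemainderLocal` and the straight-tower ℓ¹ contraction bound the
FUNCTION-level remainder `Ψ(tX) − t·DΨ(0)X` in that ℓ¹ mass by `K·t²`.  THIS FILE is the elementary calculus passing from the function-level quadratic bound to the second derivative: the mean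
value inequality applied to `h(s) = g(s) − (s²∕2)·g₂`, whose derivative `g′(s) − s·g₂` is `o(s)`.
WHAT ([folklore]; 0 def, 0 sorry; real normed spaces): **`nonneg_of_subadd_absHom`**, **`seminorm_le_of_sq_bound`** (curves `g : ℝ → F` with `g 0 = 0`, `HasDerivAt g (g′ t) t` near `0`,
`g′ 0 = 0`, `HasDerivAt g′ g₂ 0` and `p (g t) ≤ K t²` for small `t > 0` ⟹ `p g₂ ≤ 2K`, for every subadditive absolutely homogeneous `p` with `p ≤ C‖·‖`); **`hasDerivAt_ray`**,
**`hasDerivAt_fderiv_ray_apply`**, **`seminorm_fderiv_fderiv_le_of_sq_bound`** (the same for `g t = Ψ(t•X) − t•DΨ(0)X`, `Ψ` `C²` at `0`: `p (D²Ψ(0)[X,X]) ≤ 2K`).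
HONEST FRAMING (page 1): elementary calculus; nothing of Bałaban's asserted; NOT (G′), NOT NE7 as a spine node; spine 0∕9; finite T⁴ rung (B)+1 — NOT infinite volume, NOT mass gap, NOT BetaPertH,
NOT Clay.
-/

set_option autoImplicit false

open scoped Topology
open Filter Set

namespace Summit.QuantumFields.BalabanUV.T4Continuum.NE7SecondDerivativeFromQuadraticBound

variable {E F : Type*} [NormedAddCommGroup E] [NormedSpace ℝ E] [NormedAddCommGroup F] [NormedSpace ℝ F]

/-- A subadditive, absolutely homogeneous real function on a real vector space is nonnegative. [folklore] -/
theorem nonneg_of_subadd_absHom (p : F → ℝ) (hp_add : ∀ x y, p (x + y) ≤ p x + p y) (hp_smul : ∀ (c : ℝ) (x : F), p (c • x) = |c| * p x) (x : F) : 0 ≤ p x := by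
  have h0 : p 0 = 0 := by have h := hp_smul 0 x; rwa [zero_smul, abs_zero, zero_mul] at h
  have h1 := hp_add x (-x)
  rw [add_neg_cancel, h0] at h1
  have h2 : p (-x) = p x := by rw [show -x = (-1 : ℝ) • x by simp, hp_smul]; simp
  linarith

/-- **A DOMINATED SEMINORM OF THE SECOND DERIVATIVE OF A CURVE IS AT MOST TWICE ITS QUADRATIC CONSTANT**: `g 0 = 0`, `g` differentiable near `0` with `g′ 0 = 0` and `g′` differentiable at `0`
with derivative `g₂`; if `p (g t) ≤ K·t²` for all small `t > 0` then `p g₂ ≤ 2K`. [folklore] -/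
theorem seminorm_le_of_sq_bound (p : F → ℝ) {Cp : ℝ} (hp_add : ∀ x y, p (x + y) ≤ p x + p y) (hp_smul : ∀ (c : ℝ) (x : F), p (c • x) = |c| * p x)
    (hp_le : ∀ x, p x ≤ Cp * ‖x‖)
    {g g' : ℝ → F} {g₂ : F} {K : ℝ} (hg0 : g 0 = 0) (hder : ∀ᶠ t in 𝓝 (0 : ℝ), HasDerivAt g (g' t) t) (hg'0 : g' 0 = 0) (hg2 : HasDerivAt g' g₂ 0)
    (hK : ∀ᶠ t in 𝓝[>] (0 : ℝ), p (g t) ≤ K * t ^ 2) : p g₂ ≤ 2 * K := by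
  -- a nonnegative dominating constant
  have hp_le' : ∀ x, p x ≤ max Cp 0 * ‖x‖ := fun x => (hp_le x).trans (mul_le_mul_of_nonneg_right (le_max_left _ _) (norm_nonneg _))
  have hC : 0 ≤ max Cp 0 := le_max_right _ _
  refine le_of_forall_pos_lt_add fun δ hδ => ?_
  -- the accuracy `ε` with `2·C·ε < δ`
  have hε0 : 0 < δ / (2 * (max Cp 0 + 1)) := by positivity
  -- `‖g′ s − s • g₂‖ ≤ ε |s|` near `0`
  have hlin : ∀ᶠ s in 𝓝 (0 : ℝ), ‖g' s - s • g₂‖ ≤ δ / (2 * (max Cp 0 + 1)) * ‖s‖ := by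
    have h := (hasDerivAt_iff_isLittleO.mp hg2).def hε0
    refine h.mono fun s hs => ?_
    simpa [hg'0, sub_zero] using hs
  obtain ⟨r, hr0, hr⟩ : ∃ r > 0, ∀ s : ℝ, |s| < r → HasDerivAt g (g' s) s ∧ ‖g' s - s • g₂‖ ≤ δ / (2 * (max Cp 0 + 1)) * ‖s‖ := by
    obtain ⟨r, hr0, hr⟩ := Metric.eventually_nhds_iff.mp (hder.and hlin)
    exact ⟨r, hr0, fun s hs => hr (by simpa [Real.dist_eq] using hs)⟩
  -- one small `t > 0` at which the quadratic bound holds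
  have hlt : ∀ᶠ t in 𝓝[>] (0 : ℝ), t < r := nhdsWithin_le_nhds (eventually_lt_nhds hr0)
  have hpos : ∀ᶠ t in 𝓝[>] (0 : ℝ), 0 < t := eventually_mem_nhdsWithin
  obtain ⟨t, htK, htr, ht0⟩ := (hK.and (hlt.and hpos)).exists
  -- the mean value inequality for `h s = g s − (s²∕2) • g₂` on `[0, t]`
  have hq : ∀ s : ℝ, HasDerivAt (fun s : ℝ => (s ^ 2 / 2) • g₂) (s • g₂) s := fun s => by
    have h := ((hasDerivAt_pow 2 s).div_const 2).smul_const g₂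
    convert h using 2
    norm_num
  have hmv := norm_image_sub_le_of_norm_deriv_le_segment' (f := fun s : ℝ => g s - (s ^ 2 / 2) • g₂) (f' := fun s : ℝ => g' s - s • g₂)
    (a := 0) (b := t) (C := δ / (2 * (max Cp 0 + 1)) * t) (fun s hs => ?_) (fun s hs => ?_) t ⟨ht0.le, le_rfl⟩
  rotate_left
  · have hs' : |s| < r := by rw [abs_of_nonneg hs.1]; exact lt_of_le_of_lt hs.2 htr
    exact ((hr s hs').1.sub (hq s)).hasDerivWithinAt
  · have hs' : |s| < r := by rw [abs_of_nonneg hs.1]; exact lt_of_lt_of_le hs.2 htr.le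
    have h := (hr s hs').2
    have hsn : ‖s‖ ≤ t := by rw [Real.norm_eq_abs, abs_of_nonneg hs.1]; exact hs.2.le
    exact h.trans (mul_le_mul_of_nonneg_left hsn hε0.le)
  have h00 : g 0 - ((0 : ℝ) ^ 2 / 2) • g₂ = 0 := by simp [hg0]
  rw [h00, sub_zero] at hmv
  -- `(t²∕2)·p g₂ ≤ p (g t) + C·‖(t²∕2)•g₂ − g t‖ ≤ K t² + C ε t²`
  have hsplit : p ((t ^ 2 / 2) • g₂) ≤ p (g t) + p ((t ^ 2 / 2) • g₂ - g t) := by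
    have h := hp_add (g t) ((t ^ 2 / 2) • g₂ - g t); rwa [add_sub_cancel] at h
  have hrem : p ((t ^ 2 / 2) • g₂ - g t) ≤ max Cp 0 * (δ / (2 * (max Cp 0 + 1)) * t * (t - 0)) :=
    (hp_le' _).trans (by rw [norm_sub_rev]; exact mul_le_mul_of_nonneg_left hmv hC)
  have hhom : p ((t ^ 2 / 2) • g₂) = t ^ 2 / 2 * p g₂ := by rw [hp_smul, abs_of_nonneg (by positivity)]
  have hpg := nonneg_of_subadd_absHom p hp_add hp_smul g₂
  have ht2 : 0 < t ^ 2 := by positivity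
  have key : p g₂ * t ^ 2 ≤ (2 * K + 2 * (max Cp 0 * (δ / (2 * (max Cp 0 + 1))))) * t ^ 2 := by nlinarith
  have hfin : p g₂ ≤ 2 * K + 2 * (max Cp 0 * (δ / (2 * (max Cp 0 + 1)))) := le_of_mul_le_mul_right key ht2
  have hsmallδ : 2 * (max Cp 0 * (δ / (2 * (max Cp 0 + 1)))) < δ := by
    rw [show 2 * (max Cp 0 * (δ / (2 * (max Cp 0 + 1)))) = δ * (max Cp 0 / (max Cp 0 + 1)) by field_simp]
    have h1 : max Cp 0 / (max Cp 0 + 1) < 1 := by rw [div_lt_one (by positivity)]; linarith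
    calc δ * (max Cp 0 / (max Cp 0 + 1)) < δ * 1 := mul_lt_mul_of_pos_left h1 hδ
      _ = δ := mul_one δ
  linarith

/-- Derivative of the ray composite `t ↦ Ψ (t • X)` at a point where `Ψ` is differentiable. [folklore] -/
theorem hasDerivAt_ray {Ψ : E → F} (X : E) {t : ℝ} (hΨ : DifferentiableAt ℝ Ψ (t • X)) :
    HasDerivAt (fun s : ℝ => Ψ (s • X)) (fderiv ℝ Ψ (t • X) X) t := by
  have h := hΨ.hasFDerivAt.comp_hasDerivAt t ((hasDerivAt_id t).smul_const X)
  simpa [Function.comp_def] using h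

/-- Derivative at `0` of `t ↦ DΨ(t • X) X` for `Ψ` `C²` at `0`: it is `D²Ψ(0)[X,X]`. [folklore] -/
theorem hasDerivAt_fderiv_ray_apply {Ψ : E → F} (hΨ : ContDiffAt ℝ 2 Ψ 0) (X : E) :
    HasDerivAt (fun s : ℝ => fderiv ℝ Ψ (s • X) X) (fderiv ℝ (fderiv ℝ Ψ) 0 X X) 0 := by
  have hD : HasFDerivAt (fderiv ℝ Ψ) (fderiv ℝ (fderiv ℝ Ψ) 0) ((0 : ℝ) • X) := by
    rw [zero_smul]
    exact ((hΨ.fderiv_right (by norm_num)).differentiableAt one_ne_zero).hasFDerivAt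
  have hc : HasDerivAt (fun s : ℝ => fderiv ℝ Ψ (s • X)) (fderiv ℝ (fderiv ℝ Ψ) 0 ((1 : ℝ) • X)) 0 :=
    hD.comp_hasDerivAt 0 ((hasDerivAt_id (0 : ℝ)).smul_const X)
  have h := hc.clm_apply (hasDerivAt_const (0 : ℝ) X)
  simpa using h

/-- **A DOMINATED SEMINORM OF `D²Ψ(0)[X,X]` IS AT MOST TWICE THE QUADRATIC CONSTANT OF `Ψ(tX) − t·DΨ(0)X`** (see the module docstring). [folklore] -/
theorem seminorm_fderiv_fderiv_le_of_sq_bound (p : F → ℝ) {Cp : ℝ} (hp_add : ∀ x y, p (x + y) ≤ p x + p y) (hp_smul : ∀ (c : ℝ) (x : F), p (c • x) = |c| * p x)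
    (hp_le : ∀ x, p x ≤ Cp * ‖x‖) {Ψ : E → F} (hΨ : ContDiffAt ℝ 2 Ψ 0) (hΨ0 : Ψ 0 = 0) (X : E) {K : ℝ}
    (hK : ∀ᶠ t in 𝓝[>] (0 : ℝ), p (Ψ (t • X) - t • fderiv ℝ Ψ 0 X) ≤ K * t ^ 2) :
    p (fderiv ℝ (fderiv ℝ Ψ) 0 X X) ≤ 2 * K := by
  -- `Ψ` is differentiable near `0`, hence along the ray near `t = 0`
  have hd' : ∀ᶠ y : E in 𝓝 0, DifferentiableAt ℝ Ψ y := (hΨ.eventually (by simp)).mono fun y hy => hy.differentiableAt (by simp)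
  have hray : Tendsto (fun s : ℝ => s • X) (𝓝 0) (𝓝 0) := by
    have hc : Continuous fun s : ℝ => s • X := continuous_id.smul continuous_const
    have h := hc.tendsto 0
    rwa [zero_smul] at h
  have hder : ∀ᶠ t in 𝓝 (0 : ℝ), HasDerivAt (fun s : ℝ => Ψ (s • X) - s • fderiv ℝ Ψ 0 X) (fderiv ℝ Ψ (t • X) X - fderiv ℝ Ψ 0 X) t := by
    filter_upwards [hray.eventually hd'] with t ht
    have h := (hasDerivAt_ray X ht).sub ((hasDerivAt_id t).smul_const (fderiv ℝ Ψ 0 X))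
    simpa [Pi.sub_def] using h
  refine seminorm_le_of_sq_bound p hp_add hp_smul hp_le (g := fun s : ℝ => Ψ (s • X) - s • fderiv ℝ Ψ 0 X)
    (g' := fun s : ℝ => fderiv ℝ Ψ (s • X) X - fderiv ℝ Ψ 0 X) (by simp [hΨ0]) hder (by simp) ?_ hK
  exact (hasDerivAt_fderiv_ray_apply hΨ X).sub_const (fderiv ℝ Ψ 0 X)

end Summit.QuantumFields.BalabanUV.T4Continuum.NE7SecondDerivativeFromQuadraticBound
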